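import Summits.HodgeConjecture.HodgeConjecture.Theses.NodalThetaWeil
import Literature.AlgebraicGeometry.HodgeTheory.SupportedHodgeClassesAlgebraic
import Literature.AlgebraicGeometry.HodgeTheory.SupportedHodgeClassDescent
import Literature.AlgebraicGeometry.HodgeTheory.ComplexOrientationFamily
import Literature.AlgebraicGeometry.HodgeTheory.GysinFormalismPushforward
import Literature.AlgebraicGeometry.HodgeTheory.LefschetzOneOneHolds
import Literature.AlgebraicGeometry.HodgeTheory.SaitoGrFDeRhamCurveNetHolds
import Literature.AlgebraicGeometry.Resolution.ProjectiveResolutionProofs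
import Literature.AlgebraicTopology.SingularHomology.GysinMapSupportProofs
import Summits.HodgeConjecture.HodgeConjecture.Theorems.CurveNetMordellWeilVerticalSupportMiddleStubSteinFreeTransfer
import HarnessLib

/-!
# Crux `NodeDualClassesAlgebraic` (stmt-HodgeConjecture-7745), line `birth` — stub 1
# `stub_weilSupportedClassDescent`: DESCENT OF A SUPPORTED CLASS TO RESOLVED DIVISORS

Route `HodgeConjecture/NodalThetaWeil`; registered skeleton `Cruxes/NodeDualClassesAlgebraic/Lines/birth.lean`
(`NodeDualClassesAlgebraic_of`: STUB 1 descent (this file) → STUB 2 the lifted `(2,2)`-classes push forward to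
algebraic classes (THE HEART, open; HC one dimension down in Gysin form) → the crux BY NAME). After this file the
crux is, in the kernel, exactly STUB 2 (§2).

**Theorem** (`stub_weilSupportedClassDescent`, the registered signature verbatim). On a complex abelian sixfold
`(A, φ ≫ φ = -d·𝟙)`, a rational `(3,3)`-class `c` (the Weil-plane hypothesis is carried but not used) lying in
`N¹H⁶(A(ℂ); ℂ) = supportedClasses A.X 6 1` belongs to
`(⨆_{Y, g : Y ⟶ A, dim Y = 5} g_* span_ℂ {rational (2,2)-classes of Y}) ⊔ algebraicClasses A.X 3`.

Proof (all inputs are theorems of the tree). `c` dies off a Zariski-closed `Z` all of whose points have codimension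
`≥ 1` (`exists_isClosed_of_mem_supportedClasses`), hence `Z ≠ A` (the landed `ne_univ_of_forall_one_le_coheight`).
Deligne's Cor. 8.2.8 with Hironaka and Voisin's polarised lifting (the tree's
`mem_iSup_map_complexGysin_of_restrictCompl_eq_zero_of_ne_univ`, fed with the PROVED named facts
`Deligne1974_ker_restrictCompl_eq_iSup_range_complexGysin_holds`, `Voisin2025_hodgeClass_lift_complexGysin_holds`,
`Resolution.Hironaka1964_projective_holds` and `hasPoincareDuality_complexOrientationFamily`) write
`c = Σ_j (g_j)_* b_j` over smooth projective `W_j → A` of dimension `6 - e`, `e ∈ {1, 2, 3}`, with `b_j` rational of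
type `(3-e, 3-e)`. The `e = 1` summands are the first term verbatim; for `e = 2`, `b_j` is a rational
`(1,1)`-class on a fourfold, algebraic by Lefschetz `(1,1)` (`lefschetzOneOne_rational_holds`), and for `e = 3`,
`b_j ∈ H⁰ = N⁰H⁰` (`supportedClasses_zero`); Gysin images of algebraic classes are algebraic with the codimension
shift `e` (`map_complexGysin_algebraicClasses_le` with `gysinMap_restrictCompl_eq_zero_of_field ℂ`), so these land
in `algebraicClasses A.X 3`.

HONEST STATUS. Descent bookkeeping; nothing here is a case of the Hodge conjecture. STUB 2 (HC for the lifted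
`(2,2)`-classes of resolved supporting divisors, Thomas 2005 §3) remains the crux. No definition, no named fact,
no sorry.
References: [DeligneHodgeIII1974] Cor. 8.2.8; [Voisin2025] Cor. 2.12; [Kollar2007] Thm. 3.27; [VoisinHodgeI2002]
Thm. 11.30; [FultonYoungTableaux1997] App. B Ex. 5; [Thomas2005Nodes] §3 Lemmas 3–4.
-/

set_option linter.dupNamespace false

noncomputable section

open CategoryTheory AlgebraicGeometry
open Literature.AlgebraicGeometry Literature.AlgebraicGeometry.Motives Literature.AlgebraicGeometry.HodgeTheory
open Literature.AlgebraicTopology.SingularHomology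
open Summit.HodgeConjecture.HodgeConjecture.Theses.NodalThetaWeil

namespace Summit.HodgeConjecture.HodgeConjecture.Theorems.NodeDualClassesAlgebraic

/-! ## §1 The stub, in the registered spelling -/

/-- **Stub `stub_weilSupportedClassDescent` of crux `NodeDualClassesAlgebraic` (registered signature,
verbatim): descent of a supported Weil class to the resolved divisor.** A rational `(3,3)`-class of
`N¹H⁶(A)` on an abelian sixfold lies in `(⨆_{Y⁵, g} g_* span{rational (2,2)}) ⊔ algebraicClasses A.X 3`
(Deligne 8.2.8 + Hironaka + Voisin's polarised lifting, then Lefschetz `(1,1)` / `N⁰H⁰ = H⁰` and the Gysin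
codimension shift for the lower-dimensional components). [cite: DeligneHodgeIII1974, Cor. 8.2.8]
[cite: Voisin2025, Cor. 2.12] [cite: VoisinHodgeI2002, Thm. 11.30] [cite: FultonYoungTableaux1997, Appendix B §B.2 Exercise 5] -/
theorem stub_weilSupportedClassDescent :
  ∀ (d : ℕ), 0 < d → ∀ (A : AbelianVariety ℂ) (φ : A ⟶ A), A.dim = 2 * 3 →
    ∀ (hX : IsSmoothProjective (2 * 3) A.X), φ ≫ φ = -(d • 𝟙 A) →
    ∀ c : singularCohomology ℂ ℂ (ComplexPoints A.X) (2 * 3), IsRationalClass c →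
    IsOfHodgeType (2 * 3) A.X (2 * 3) 3 3 c →
    (∃ c₁ c₂ : singularCohomology ℂ ℂ (ComplexPoints A.X) (2 * 3), c = c₁ + c₂ ∧
      (∀ x y : ℕ, singularCohomology.map ℂ ℂ (AlgPoints.mapContinuous (L := ℂ) (x • 𝟙 A + y • φ).hom.hom.hom) (2 * 3) c₁ =
        ((x : ℂ) + (y : ℂ) * Complex.I * (Real.sqrt d : ℂ)) ^ (2 * 3) • c₁) ∧
      (∀ x y : ℕ, singularCohomology.map ℂ ℂ (AlgPoints.mapContinuous (L := ℂ) (x • 𝟙 A + y • φ).hom.hom.hom) (2 * 3) c₂ =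
        ((x : ℂ) - (y : ℂ) * Complex.I * (Real.sqrt d : ℂ)) ^ (2 * 3) • c₂)) →
    c ∈ supportedClasses A.X (2 * 3) 1 →
    c ∈ (⨆ (Y : SchemeOver ℂ) (hY : IsSmoothProjective 5 Y) (g : Y ⟶ A.X),
          (Submodule.span ℂ {b : complexBetti Y (2 * 2) |
              IsRationalClass b ∧ IsOfHodgeType 5 Y (2 * 2) 2 2 b}).map
            (complexGysin complexOrientationFamily hY hX g
              (show 2 * 2 + 2 * (2 * 3) = 2 * 3 + 2 * 5 by norm_num))) ⊔
        algebraicClasses A.X 3 := by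
  intro d _hd A φ _hdim hX _hφ c hc hH _hw hN
  -- a proper Zariski-closed `Z` off which `c` dies
  obtain ⟨Z, hZ, hcoh, hcZ⟩ := exists_isClosed_of_mem_supportedClasses hN
  have hZne : Z ≠ Set.univ := ne_univ_of_forall_one_le_coheight hX hcoh
  -- Deligne 8.2.8 + Hironaka + Voisin: `c = Σ (g_j)_* b_j`, `b_j` rational of type `(3-e, 3-e)` on
  -- smooth projective `W_j → A` of dimension `6 - e`, `1 ≤ e`
  have key := mem_iSup_map_complexGysin_of_restrictCompl_eq_zero_of_ne_univ
    Deligne1974_ker_restrictCompl_eq_iSup_range_complexGysin_holds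
    Voisin2025_hodgeClass_lift_complexGysin_holds Resolution.Hironaka1964_projective_holds
    complexOrientationFamily hasPoincareDuality_complexOrientationFamily hX hZ hZne hc hH hcZ
  refine SetLike.le_def.mp (iSup_le fun d' ↦ iSup_le fun e ↦ iSup_le fun hde ↦ iSup_le fun he ↦
    iSup_le fun W ↦ iSup_le fun m' ↦ iSup_le fun hm' ↦ iSup_le fun hW ↦ iSup_le fun g ↦ ?_) key
  obtain rfl | rfl | rfl : e = 1 ∨ e = 2 ∨ e = 3 := by omega
  · -- `e = 1`: fivefolds and rational `(2,2)`-classes — the first term verbatim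
    obtain rfl : d' = 2 := by omega
    obtain rfl : m' = 5 := by omega
    exact le_sup_of_le_left (le_iSup_of_le W (le_iSup_of_le hW (le_iSup_of_le g le_rfl)))
  · -- `e = 2`: fourfolds and rational `(1,1)`-classes — algebraic by Lefschetz `(1,1)`
    obtain rfl : d' = 1 := by omega
    obtain rfl : m' = 4 := by omega
    refine le_sup_of_le_right ?_
    rintro _ ⟨b, hb, rfl⟩
    have hbalg : b ∈ algebraicClasses W 1 :=
      (Submodule.span_le.2 fun b' hb' ↦ lefschetzOneOne_rational_holds hW b' hb'.1 hb'.2) hb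
    exact map_complexGysin_algebraicClasses_le (gysinMap_restrictCompl_eq_zero_of_field ℂ)
      complexOrientationFamily hasPoincareDuality_complexOrientationFamily hW hX g
      (d := 1) (e := 2) (show 4 + 2 = 2 * 3 by norm_num) ⟨b, hbalg, rfl⟩
  · -- `e = 3`: threefolds and `H⁰ = N⁰H⁰`
    obtain rfl : d' = 0 := by omega
    obtain rfl : m' = 3 := by omega
    refine le_sup_of_le_right ?_
    rintro _ ⟨b, -, rfl⟩
    have hbalg : b ∈ algebraicClasses W 0 := by
      change b ∈ supportedClasses W (2 * 0) 0
      rw [supportedClasses_zero]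
      trivial
    exact map_complexGysin_algebraicClasses_le (gysinMap_restrictCompl_eq_zero_of_field ℂ)
      complexOrientationFamily hasPoincareDuality_complexOrientationFamily hW hX g
      (d := 0) (e := 3) (show 3 + 3 = 2 * 3 by norm_num) ⟨b, hbalg, rfl⟩

/-! ## §2 The crux from STUB 2 alone -/

/-- **The crux `NodeDualClassesAlgebraic` BY NAME from STUB 2 alone** (the skeleton's composition
`NodeDualClassesAlgebraic_of` with STUB 1 = `stub_weilSupportedClassDescent` (this file) discharged): the
hypothesis is the registered signature of `stub_liftedTwoTwoClassesAlgebraic`, verbatim.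
[cite: Thomas2005Nodes, §3 Lemmas 3–4] [cite: DeligneHodgeIII1974, Cor. 8.2.8] -/
theorem nodeDualClassesAlgebraic_of_liftedTwoTwoClassesAlgebraic
    (h₂ : ∀ (d : ℕ), 0 < d → ∀ (A : AbelianVariety ℂ) (φ : A ⟶ A), A.dim = 2 * 3 →
      ∀ (hX : IsSmoothProjective (2 * 3) A.X), φ ≫ φ = -(d • 𝟙 A) →
      ∀ (Y : SchemeOver ℂ) (hY : IsSmoothProjective 5 Y) (g : Y ⟶ A.X) (b : complexBetti Y (2 * 2)),
      IsRationalClass b → IsOfHodgeType 5 Y (2 * 2) 2 2 b →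
      complexGysin complexOrientationFamily hY hX g
          (show 2 * 2 + 2 * (2 * 3) = 2 * 3 + 2 * 5 by norm_num) b ∈ algebraicClasses A.X 3) :
    Summit.HodgeConjecture.HodgeConjecture.Theses.NodalThetaWeil.NodeDualClassesAlgebraic := by
  intro d hd A φ hdim hX hφ c hr hh hw hs
  have hmem := stub_weilSupportedClassDescent d hd A φ hdim hX hφ c hr hh hw hs
  have hle : (⨆ (Y : SchemeOver ℂ) (hY : IsSmoothProjective 5 Y) (g : Y ⟶ A.X),
      (Submodule.span ℂ {b : complexBetti Y (2 * 2) |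
          IsRationalClass b ∧ IsOfHodgeType 5 Y (2 * 2) 2 2 b}).map
        (complexGysin complexOrientationFamily hY hX g
          (show 2 * 2 + 2 * (2 * 3) = 2 * 3 + 2 * 5 by norm_num))) ≤ algebraicClasses A.X 3 := by
    refine iSup_le fun Y ↦ iSup_le fun hY ↦ iSup_le fun g ↦ ?_
    rw [Submodule.map_le_iff_le_comap, Submodule.span_le]
    rintro b ⟨hb, hb'⟩
    rw [SetLike.mem_coe, Submodule.mem_comap]
    exact h₂ d hd A φ hdim hX hφ Y hY g b hb hb'
  exact (sup_le hle le_rfl) hmem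

end Summit.HodgeConjecture.HodgeConjecture.Theorems.NodeDualClassesAlgebraic

end
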